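import Summits.QuantumFields.BalabanUV.Beta.CombHId2W2Words

/-!
# `BalabanUV.Beta.CombHId2W2Mixed` — binder row D1 (OWNER an2), (J-a) dictionary, (C2) at ORDER 2, part TWO-c (words, continued): **WORD 3 — THE MIXED TABLE WITH THE
# MOVING BOND OUTSIDE**, `Σ'_n mixOfK K N M₂ (b′+M′∘n) b = mixOfK K N M₂^{csf} b′ b` (the FINE index copy-summed), its periodisation `mixOfK K N M₂^{per,csf} b′ b`, and the
# identification `M₂^{per,csf} = M₂^{per,cs}` under the mixed table's joint period covariance

WHY.  In `W2OfK … b b′` the mixed table enters twice, `mixOfK M₂ b b′` (moving bond inside — `CombHId2W2Words` §2) and `mixOfK M₂ b′ b` (moving bond OUTSIDE — here).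
Outside, the outer column's fine slot is re-indexed (`vertexOfK_translate_per`), so the copies run over the mixed table's FINE index; after `dper` the two copy sums
agree by the table's joint covariance `M₂ κ (u+M∘m) ρ (w+M′∘m) (x+M∘m) (z+M∘m) = M₂ κ u ρ w x z` (`(Tmix)` in period form).
WHAT ([folklore]; 0 `def`, 0 cited fact, 0 `def … : Prop`, 0 sorry): §3 `abs_M₂_fine_copy_le`, **`tsum_word₃`**; §4 `vertexFamily_M₂_csf` (the fine-index copy sum is a vertex
family in the coarse index, rate `δm∕3` — `exp_thirds`, thirds of the exponent), **`dper_tsum_word₃`** (`= mixOfK K N M₂^{per,csf} b′ b`); §5 `M₂_fine_copy_eq_shiftK`, **`dper_csf_eq_dper_cs`**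
(`M₂^{per,csf} = M₂^{per,cs}`, `CombHId2W2Slot.dper_tsum_family'` on both sides + C3c `dper_shiftK_per`), **`dper_tsum_word₃'`** (`= mixOfK K N M₂^{per,cs} b′ b`).
NOT HERE: word 1, `W2SymOfK`; nothing of Bałaban's asserted; NOT D1, NEVER «G-an2-4 closed», NOT BetaPertH, NOT continuum, NOT Clay.

HONEST DEPENDENCY (page 1, mandatory): continuum YM on T⁴ ⇐ BetaPertH ∧ nine spine estimates (0/9 proved); BetaPertH ⇐ (D1) ∧ (D4) ∧ CAP+tail;
G-an2-4 gates asym, D1 and NE2/3/4.  HONEST FRAMING (cell contract, verbatim): «discharging `BetaPertH` makes Bałaban's UV stability UNCONDITIONAL —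
a real constructive-QFT result; it is NOT the continuum limit and NOT the Clay problem.»  ABSOLUTE RULE (cell charter, verbatim): «No internally-minted
statement may enter as a cited fact. Every hypothesis is either kernel-proved in this package or a verbatim quotation of a PUBLISHED theorem with page
reference. The manuscript(s) under audit are NOT citable for their own disputed steps — they are the thing under adjudication; programme-internal
(2001/route/tribunal) claims are never citable.»  Row D1 OWNER an2 (b2b-balaban-beta-an2) gen 44, 2026-08-23; over `CombHId2W2Letters∕Exchange∕Slot∕Words`, C3a∕C3c BY NAME.
-/

noncomputable section

open scoped BigOperators

namespace Summit.QuantumFields.BalabanUV.Beta.CombHId2W2Mixed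

open Literature.MathematicalPhysics.QuantumFieldTheory.Balaban1983to89
open Literature.MathematicalPhysics.QuantumFieldTheory.Balaban1983to89.Beta
open B12Sec2to5 (l1 l1_nonneg)
open B4TorusKernel.MultiPeriod (translate translate_apply)
open B4Reflection242 (translate_translate)
open B4Sect5Proof (latticeConst latticeConst_nonneg)
open ExpKernelCalculus (MKer Decays BiLoc VertexFamily comp shiftK l1_sub_symm l1_sub_triangle)
open AffineAveraging (Site)
open OneStepResolventKernel (Fib)
open OneStepKernelFamily (vertexOfK)
open SecondOrderResponse (vertexOfM mixOfK)
open Summit.QuantumFields.BalabanUV.Beta.FP.KernelPeriodisationFibLoc (dper dper_apply dper_translate shiftK_eq_translate summable_exp_l1_translate)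
open Summit.QuantumFields.BalabanUV.Beta.CombHId2CopySum (dper_shiftK_per)
open Summit.QuantumFields.BalabanUV.Beta.CombHId2W2Letters (exp_rate_mono)
open Summit.QuantumFields.BalabanUV.Beta.CombHId2W2Exchange (vertexOfK_translate_per dper_vertexOfK_of_biLocAt dper_vertexOfM')
open Summit.QuantumFields.BalabanUV.Beta.CombHId2W2Slot (tsum_vertexOfK_slot tsum_vertexOfM_slot abs_vertexOfM_le_of_far dper_tsum_family')

variable {d : ℕ} (M : Fin (d + 1) → ℕ) [∀ μ, NeZero (M μ)] {N : ℕ} [NeZero N] {M' : Fin (d + 1) → ℕ} {K : MKer (d + 1) (Fib d)}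
  {CK δK Cm δm : ℝ} {M₂ : Fin (d + 1) → Site (d + 1) → Fin (d + 1) → Site (d + 1) → MKer (d + 1) (Fib d)}

/-! ## §3 Word 3: the mixed table with the moving bond OUTSIDE (`mixOfK K N M₂ (b′+M′∘n) b`) -/

section Word3

omit [∀ μ, NeZero (M μ)] [NeZero N] in
/-- [folklore] the mixed table read at the shifted FINE index `u + M∘n` is localised away from the inner column at `u + M∘n`:
`|M₂ κ (u + M∘n) ρ w x z a c| ≤ Cm·e^{−δm|u + M∘n − N•w|₁}`. -/
theorem abs_M₂_fine_copy_le (hM₂ : SecondOrderResponse.LocStencilFM N M₂ Cm δm) (hδm : 0 ≤ δm)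
    (κ : Fin (d + 1)) (u n : Site (d + 1)) (ρ : Fin (d + 1)) (w x z : Site (d + 1)) (a c : Fib d) :
    |M₂ κ (translate M u n) ρ w x z a c| ≤ Cm * Real.exp (-δm * l1 (translate M u n - (N : ℤ) • w)) := by
  have hCm : 0 ≤ Cm := hM₂.nonneg
  refine (hM₂ κ (translate M u n) ρ w x z a c).trans ?_
  have h1 : Real.exp (-δm * (l1 (x - translate M u n) + l1 (z - translate M u n))) ≤ 1 := by
    rw [Real.exp_le_one_iff]; exact mul_nonpos_of_nonpos_of_nonneg (neg_nonpos.2 hδm) (add_nonneg (l1_nonneg _) (l1_nonneg _))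
  calc Cm * Real.exp (-δm * l1 (translate M u n - (N : ℤ) • w)) * Real.exp (-δm * (l1 (x - translate M u n) + l1 (z - translate M u n)))
      ≤ Cm * Real.exp (-δm * l1 (translate M u n - (N : ℤ) • w)) * 1 := mul_le_mul_of_nonneg_left h1 (by positivity)
    _ = _ := mul_one _

/-- [folklore] **`Σ'_n mixOfK K N M₂ (b′+M′∘n) b = mixOfK K N M₂^{csf} b′ b`** (pointwise), `M₂^{csf} κ u ρ w := x z a c ↦ Σ'_n M₂ κ (u + M∘n) ρ w x z a c` (the FINE index
copy-summed): the moving bond is the OUTER column (`vertexOfK_translate_per` re-indexes the fine slot), the copies then sum inside both slots. -/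
theorem tsum_word₃ (hM : ∀ i, M i = N * M' i)
    (hKinv : ∀ (m x z : Site (d + 1)) (a b : Fib d), K (translate M x m) (translate M z m) a b = K x z a b)
    (hK : Decays K CK δK) (hδK : 0 < δK) (hM₂ : SecondOrderResponse.LocStencilFM N M₂ Cm δm) (hδm : 0 < δm)
    (μ : Fin (d + 1)) (y : Site (d + 1)) (ν : Fin (d + 1)) (y' : Site (d + 1)) (x z : Site (d + 1)) (a c : Fib d) :
    ∑' n : Site (d + 1), SecondOrderResponse.mixOfK K N M₂ ν (translate M' y' n) μ y x z a c
      = SecondOrderResponse.mixOfK K N (fun κ u ρ w => fun x z a c => ∑' n : Site (d + 1), M₂ κ (translate M u n) ρ w x z a c) ν y' μ y x z a c := by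
  have hCK : 0 ≤ CK := hK.nonneg (Sum.inl 0)
  have hCm : 0 ≤ Cm := hM₂.nonneg
  set r : ℝ := min δK δm with hr
  have hr0 : 0 < r := lt_min hδK hδm
  set Z : ℝ := ∑' w : Site (d + 1), Real.exp (-(r / 2) * l1 ((N : ℤ) • w - (N : ℤ) • y)) with hZ
  have hZ0 : 0 ≤ Z := tsum_nonneg fun w => (Real.exp_pos _).le
  -- the outer family after re-indexing `n ↦ −n`: `F n κ u := vertexOfM K N (M₂ κ (u + M∘(−n))) μ y`
  set F : Site (d + 1) → Fin (d + 1) → Site (d + 1) → MKer (d + 1) (Fib d) :=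
    fun n κ u => vertexOfM K N (M₂ κ (translate M u (-n))) μ y with hF
  have hFb : ∀ n κ u x z a c, |F n κ u x z a c| ≤ ((d + 1 : ℕ) * (CK * Cm * Z)) * Real.exp (-(r / 2) * l1 (translate M ((N : ℤ) • y) n - u)) := by
    intro n κ u x z a c
    have h := abs_vertexOfM_le_of_far (N := N) hK hδK (G := M₂ κ (translate M u (-n))) (q := translate M u (-n))
      (fun ρ w x z a c => abs_M₂_fine_copy_le M hM₂ hδm.le κ u (-n) ρ w x z a c) hCm hδm μ y x z a c
    have e : l1 (translate M u (-n) - (N : ℤ) • y) = l1 (translate M ((N : ℤ) • y) n - u) := by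
      rw [l1_sub_symm]; congr 1; funext i; simp only [Pi.sub_apply, translate_apply, Pi.neg_apply, mul_neg]; ring
    rw [e] at h
    exact h
  -- step 1: move the bond to the fine slot, re-index the outer sum
  have h1 : ∀ n, SecondOrderResponse.mixOfK K N M₂ ν (translate M' y' n) μ y = vertexOfK K N (F (-n)) ν y' := by
    intro n
    show vertexOfK K N (fun κ u => vertexOfM K N (M₂ κ u) μ y) ν (translate M' y' n) = _
    rw [vertexOfK_translate_per M hM hKinv _ ν y' n, hF]
    simp only [neg_neg]
  simp only [h1]
  rw [← (Equiv.neg (Site (d + 1))).tsum_eq fun n => vertexOfK K N (F (-n)) ν y' x z a c]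
  simp only [Equiv.neg_apply, neg_neg]
  -- step 2: the outer slot
  rw [tsum_vertexOfK_slot M hK hδK hFb (by positivity) (half_pos hr0) ν y' x z a c]
  -- step 3: the inner slot (re-index `n ↦ −n` once more)
  show vertexOfK K N (fun κ u => fun x z a c => ∑' n : Site (d + 1), F n κ u x z a c) ν y' x z a c = _
  congr 1
  funext κ u x' z' a' c'
  rw [hF]
  dsimp only
  rw [← (Equiv.neg (Site (d + 1))).tsum_eq fun n => vertexOfM K N (M₂ κ (translate M u (-n))) μ y x' z' a' c']
  simp only [Equiv.neg_apply, neg_neg]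
  exact tsum_vertexOfM_slot M hK hδK (G := fun n ρ w => M₂ κ (translate M u n) ρ w) (p := u)
    (fun n ρ w x z a c => abs_M₂_fine_copy_le M hM₂ hδm.le κ u n ρ w x z a c) hCm hδm μ y x' z' a' c'

end Word3

/-! ## §4 The fine-index copy sum is a vertex family in the coarse index; word 3 periodised -/

section Word3Per

omit [NeZero N] in
/-- [folklore] thirds of the exponent: `e^{−δ(A+B+C)} ≤ e^{−(δ∕3)(A+B)}·e^{−(δ∕3)(A+C)}·e^{−(δ∕3)B}` for `A, B, C, δ ≥ 0`. -/
theorem exp_thirds {δ A B C : ℝ} (hδ : 0 ≤ δ) (hA : 0 ≤ A) (hB : 0 ≤ B) (hC : 0 ≤ C) :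
    Real.exp (-δ * (A + B + C)) ≤ Real.exp (-(δ / 3) * (A + B)) * Real.exp (-(δ / 3) * (A + C)) * Real.exp (-(δ / 3) * B) := by
  rw [← Real.exp_add, ← Real.exp_add, Real.exp_le_exp]
  nlinarith [mul_nonneg hδ hA, mul_nonneg hδ hB, mul_nonneg hδ hC]

omit [NeZero N] in
/-- [folklore] **THE FINE-INDEX COPY SUM OF THE MIXED TABLE IS A VERTEX FAMILY IN ITS COARSE INDEX** (uniformly in the fine bond): for `LocStencilFM N M₂ Cm δm`,
`|Σ'_n M₂ κ (u+M∘n) ρ w x z a c| ≤ (Cm·K_{d+1}(δm∕3))·e^{−(δm∕3)(|x−N•w|₁ + |z−N•w|₁)}` — each copy is a bump at `u+M∘n` with weight `e^{−δm|u+M∘n−N•w|₁}`; thirds of the exponent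
leave one summable factor in `n`. -/
theorem vertexFamily_M₂_csf (hM₂ : SecondOrderResponse.LocStencilFM N M₂ Cm δm) (hδm : 0 < δm) (κ : Fin (d + 1)) (u : Site (d + 1)) :
    VertexFamily (fun ρ w => fun x z a c => ∑' n : Site (d + 1), M₂ κ (translate M u n) ρ w x z a c) N (Cm * latticeConst (d + 1) (δm / 3)) (δm / 3) := by
  have hCm : 0 ≤ Cm := hM₂.nonneg
  intro ρ w x z a c
  obtain ⟨hs, hle⟩ := summable_exp_l1_translate M (show 0 < δm / 3 by positivity) x u
  have hterm : ∀ n, |M₂ κ (translate M u n) ρ w x z a c|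
      ≤ Cm * Real.exp (-(δm / 3) * (l1 (x - (N : ℤ) • w) + l1 (z - (N : ℤ) • w))) * Real.exp (-(δm / 3) * l1 (translate M u n - x)) := by
    intro n
    refine (hM₂ κ (translate M u n) ρ w x z a c).trans ?_
    have hA := l1_nonneg (translate M u n - (N : ℤ) • w)
    have hB := l1_nonneg (x - translate M u n)
    have hC := l1_nonneg (z - translate M u n)
    have tx : l1 (x - (N : ℤ) • w) ≤ l1 (x - translate M u n) + l1 (translate M u n - (N : ℤ) • w) := l1_sub_triangle _ _ _
    have tz : l1 (z - (N : ℤ) • w) ≤ l1 (z - translate M u n) + l1 (translate M u n - (N : ℤ) • w) := l1_sub_triangle _ _ _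
    rw [mul_assoc, ← Real.exp_add, mul_assoc, ← Real.exp_add, l1_sub_symm (translate M u n) x]
    refine mul_le_mul_of_nonneg_left (Real.exp_le_exp.2 ?_) hCm
    nlinarith [mul_nonneg hδm.le hA, mul_nonneg hδm.le hB, mul_nonneg hδm.le hC]
  have h := tsum_of_norm_bounded ((hs.mul_left (Cm * Real.exp (-(δm / 3) * (l1 (x - (N : ℤ) • w) + l1 (z - (N : ℤ) • w))))).hasSum)
    fun n => by rw [Real.norm_eq_abs]; exact hterm n
  rw [Real.norm_eq_abs, tsum_mul_left] at h
  refine h.trans ?_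
  calc Cm * Real.exp (-(δm / 3) * (l1 (x - (N : ℤ) • w) + l1 (z - (N : ℤ) • w))) * ∑' n, Real.exp (-(δm / 3) * l1 (translate M u n - x))
      ≤ Cm * Real.exp (-(δm / 3) * (l1 (x - (N : ℤ) • w) + l1 (z - (N : ℤ) • w))) * latticeConst (d + 1) (δm / 3) :=
        mul_le_mul_of_nonneg_left hle (by positivity)
    _ = _ := by ring

/-- [folklore] **WORD 3, PERIODISED**: `dper M (x z ↦ Σ'_n mixOfK K N M₂ (b′+M′∘n) b x z) = mixOfK K N M₂^{per,csf} b′ b`,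
`M₂^{per,csf} κ u ρ w := dper M (x z ↦ Σ'_n M₂ κ (u+M∘n) ρ w x z)` (`dper_vertexOfK_of_biLocAt` at the common centre `N•b.2` of the inner vertices, then `dper_vertexOfM'`). -/
theorem dper_tsum_word₃ (hM : ∀ i, M i = N * M' i)
    (hKinv : ∀ (m x z : Site (d + 1)) (a b : Fib d), K (translate M x m) (translate M z m) a b = K x z a b)
    (hK : Decays K CK δK) (hCK : 0 ≤ CK) (hδK : 0 < δK) (hM₂ : SecondOrderResponse.LocStencilFM N M₂ Cm δm) (hδm : 0 < δm)
    (μ : Fin (d + 1)) (y : Site (d + 1)) (ν : Fin (d + 1)) (y' : Site (d + 1)) :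
    dper M (fun x z a c => ∑' n : Site (d + 1), mixOfK K N M₂ ν (translate M' y' n) μ y x z a c)
      = mixOfK K N (fun κ u ρ w => dper M (fun x z a c => ∑' n : Site (d + 1), M₂ κ (translate M u n) ρ w x z a c)) ν y' μ y := by
  have hCm : 0 ≤ Cm := hM₂.nonneg
  have hcsf := fun κ u => vertexFamily_M₂_csf M (N := N) hM₂ hδm κ u
  -- the inner vertices are localised at the common point `N•y`
  set r : ℝ := min δK (δm / 3) with hr
  have hr0 : 0 < r := lt_min hδK (by positivity)
  have hC0 : 0 ≤ Cm * latticeConst (d + 1) (δm / 3) := mul_nonneg hCm (latticeConst_nonneg _ (by positivity))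
  have hT : ∀ κ u, BiLoc (vertexOfM K N (fun ρ w => fun x z a c => ∑' n : Site (d + 1), M₂ κ (translate M u n) ρ w x z a c) μ y)
      ((N : ℤ) • y) ((N : ℤ) • y) ((d + 1 : ℕ) * (CK * (Cm * latticeConst (d + 1) (δm / 3)) * ExpKernelCalculus.Zl (d + 1) (r / 2))) (r / 2) :=
    fun κ u => SecondOrderResponse.vertexFamily_vertexOfM (N := N) hK hCK
      (BalabanStepW2.vertexFamily_mono' (hcsf κ u) hC0 (min_le_right _ _)) hr0 (min_le_left _ _) μ y
  have h1 : (fun x z a c => ∑' n : Site (d + 1), mixOfK K N M₂ ν (translate M' y' n) μ y x z a c)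
      = vertexOfK K N (fun κ u => vertexOfM K N (fun ρ w => fun x z a c => ∑' n : Site (d + 1), M₂ κ (translate M u n) ρ w x z a c) μ y) ν y' := by
    funext x z a c
    exact tsum_word₃ M hM hKinv hK hδK hM₂ hδm μ y ν y' x z a c
  rw [h1, dper_vertexOfK_of_biLocAt M hK hδK hT (half_pos hr0) ν y']
  show _ = vertexOfK K N (fun κ u => vertexOfM K N (fun ρ w => dper M (fun x z a c => ∑' n : Site (d + 1), M₂ κ (translate M u n) ρ w x z a c)) μ y) ν y'
  congr 1
  funext κ u
  exact dper_vertexOfM' M hK hδK (hcsf κ u) (by positivity) μ y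

end Word3Per

/-! ## §5 Under the mixed table's joint covariance the two copy sums have the same periodisation -/

section Ident

omit [NeZero N]

omit [∀ μ, NeZero (M μ)] in
/-- [folklore] under the joint period covariance of `M₂` the copy at the shifted FINE index is the shift of the copy at the back-shifted COARSE index:
`M₂ κ (u+M∘n) ρ w = shiftK (M∘(−n)) (M₂ κ u ρ (w + M′∘(−n)))`. -/
theorem M₂_fine_copy_eq_shiftK
    (hM₂t : ∀ (κ : Fin (d + 1)) (u : Site (d + 1)) (ρ : Fin (d + 1)) (w m x z : Site (d + 1)) (a c : Fib d),
      M₂ κ (translate M u m) ρ (translate M' w m) (translate M x m) (translate M z m) a c = M₂ κ u ρ w x z a c)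
    (κ : Fin (d + 1)) (u n : Site (d + 1)) (ρ : Fin (d + 1)) (w : Site (d + 1)) :
    M₂ κ (translate M u n) ρ w = shiftK (fun i => (M i : ℤ) * (-n) i) (M₂ κ u ρ (translate M' w (-n))) := by
  funext x z a c
  rw [shiftK_eq_translate]
  have h := hM₂t κ u ρ (translate M' w (-n)) n (translate M x (-n)) (translate M z (-n)) a c
  rw [translate_translate, translate_translate, translate_translate, neg_add_cancel, CombHId2Product.translate_zero_right,
    CombHId2Product.translate_zero_right, CombHId2Product.translate_zero_right] at h
  exact h

/-- [folklore] **`M₂^{per,csf} = M₂^{per,cs}`**: `dper M (x z ↦ Σ'_n M₂ κ (u+M∘n) ρ w x z) = dper M (x z ↦ Σ'_n M₂ κ u ρ (w+M′∘n) x z)` — both sides are `Σ'_n dper M (copy)`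
(`dper_tsum_family'`; the fine copies have moving centres), the fine copy is the shift of a coarse copy (§5), and `dper` forgets the shift (C3c `dper_shiftK_per`). -/
theorem dper_csf_eq_dper_cs (hM : ∀ i, M i = N * M' i) (hM₂ : SecondOrderResponse.LocStencilFM N M₂ Cm δm) (hδm : 0 < δm)
    (hM₂t : ∀ (κ : Fin (d + 1)) (u : Site (d + 1)) (ρ : Fin (d + 1)) (w m x z : Site (d + 1)) (a c : Fib d),
      M₂ κ (translate M u m) ρ (translate M' w m) (translate M x m) (translate M z m) a c = M₂ κ u ρ w x z a c)
    (κ : Fin (d + 1)) (u : Site (d + 1)) (ρ : Fin (d + 1)) (w : Site (d + 1)) :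
    dper M (fun x z a c => ∑' n : Site (d + 1), M₂ κ (translate M u n) ρ w x z a c)
      = dper M (fun x z a c => ∑' n : Site (d + 1), M₂ κ u ρ (translate M' w n) x z a c) := by
  have hCm : 0 ≤ Cm := hM₂.nonneg
  funext x z a c
  -- left: moving centres `u + M∘n`
  have hL := (dper_tsum_family' M (T := fun n => M₂ κ (translate M u n) ρ w) (p := fun n => translate M u n)
    (g := fun n => Cm * Real.exp (-δm * l1 (translate M u n - (N : ℤ) • w))) (fun n x z a c => hM₂ κ (translate M u n) ρ w x z a c)
    (((summable_exp_l1_translate M hδm ((N : ℤ) • w) u).1).mul_left Cm) (fun n => by positivity) hδm x z a c).1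
  -- right: fixed centre `u`
  have hR := (dper_tsum_family' M (T := fun n => M₂ κ u ρ (translate M' w n)) (p := fun _ => u)
    (g := fun n => Cm * Real.exp (-δm * l1 (translate M ((N : ℤ) • w) n - u))) (fun n x z a c => by
      have h := hM₂ κ u ρ (translate M' w n) x z a c
      rwa [CombHId1Letters.nsmul_translate hM, l1_sub_symm] at h)
    (((summable_exp_l1_translate M hδm u ((N : ℤ) • w)).1).mul_left Cm) (fun n => by positivity) hδm x z a c).1
  rw [hL, hR, ← (Equiv.neg (Site (d + 1))).tsum_eq fun n => dper M (M₂ κ u ρ (translate M' w n)) x z a c]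
  refine tsum_congr fun n => ?_
  rw [M₂_fine_copy_eq_shiftK M hM₂t κ u n ρ w, dper_shiftK_per]
  rfl

end Ident

/-- [folklore] **WORD 3, PERIODISED, IN THE COARSE COPY-SUM SHAPE**: `dper M (x z ↦ Σ'_n mixOfK K N M₂ (b′+M′∘n) b x z) = mixOfK K N M₂^{per,cs} b′ b` (joint covariance of `M₂`). -/
theorem dper_tsum_word₃' (hM : ∀ i, M i = N * M' i)
    (hKinv : ∀ (m x z : Site (d + 1)) (a b : Fib d), K (translate M x m) (translate M z m) a b = K x z a b)
    (hK : Decays K CK δK) (hCK : 0 ≤ CK) (hδK : 0 < δK) (hM₂ : SecondOrderResponse.LocStencilFM N M₂ Cm δm) (hδm : 0 < δm)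
    (hM₂t : ∀ (κ : Fin (d + 1)) (u : Site (d + 1)) (ρ : Fin (d + 1)) (w m x z : Site (d + 1)) (a c : Fib d),
      M₂ κ (translate M u m) ρ (translate M' w m) (translate M x m) (translate M z m) a c = M₂ κ u ρ w x z a c)
    (μ : Fin (d + 1)) (y : Site (d + 1)) (ν : Fin (d + 1)) (y' : Site (d + 1)) :
    dper M (fun x z a c => ∑' n : Site (d + 1), mixOfK K N M₂ ν (translate M' y' n) μ y x z a c)
      = mixOfK K N (fun κ u ρ w => dper M (fun x z a c => ∑' n : Site (d + 1), M₂ κ u ρ (translate M' w n) x z a c)) ν y' μ y := by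
  rw [dper_tsum_word₃ M hM hKinv hK hCK hδK hM₂ hδm μ y ν y']
  congr 1
  funext κ u ρ w
  exact dper_csf_eq_dper_cs M hM hM₂ hδm hM₂t κ u ρ w

end Summit.QuantumFields.BalabanUV.Beta.CombHId2W2Mixed

end
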